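import Mathlib
import Summits.ResolutionOfSingularities.ResolutionOfSingularities.Theorems.WildQuotientsWildQuotientResolutionToricExitTranslationFixed
import Summits.ResolutionOfSingularities.ResolutionOfSingularities.Theorems.WildQuotientsWildQuotientResolutionToricExitRootChartFour
import Summits.ResolutionOfSingularities.ResolutionOfSingularities.Theorems.WildQuotientsWildQuotientResolutionJordanFourTwistedChart

/-!
# R-T rung, `J₅`: the plain root chart at the `μ₄`-vertex — integral slice invariants and the fixed ring

(crux stmt-ResolutionOfSingularities-15640 `WildQuotients.WildQuotientResolution`, line `Sketch`,
sector `|G| = p`; NEXT RUNG «R-T general twisted root charts» of `L/w45c/CHAIN.md` v8 §5/(III),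
object `JordanFive.SliceX0` of res-L1-w45c-stub-1's list 2026-08-27T09:48:48Z, design of record
res-L1-w45c-idea-2 `RT-J5.md` §3 «μ₄-vertex: plain root chart and its translation normal form
(part D, all True)», machine cross-check kit j275590 (res-type-036); the `J₅` twin of
`…ToricExitRootChartFour` / `…ToricExitRootChartFourFixed` (p489957/p490684).
[OURS · L1 W4.5c] — NOT a statement of any manuscript; replaces the role of no printed item.
Prover res-type-036 (reserve, file C of the R-T `J₅` row). Def-free.)

Setting. `σ` is the Jordan block `J₅` on `k[x_a, x_b, x_c, x_d, x_e, passengers]`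
(`x_a ↦ x_a`, `x_b ↦ x_b + x_a`, …, `x_e ↦ x_e + x_d`), `V = Bl_w 𝔸ⁿ` the `(4,3,2,1)`-weighted
blow-up of the fixed locus `{x_a = x_b = x_c = x_d = 0}`. On the PLAIN ROOT CHART at the
`μ₄`-vertex (`x_a = ρ⁴`, `x_b = ρ³y₁`, `x_c = ρ²y₂`, `x_d = ρy₃`, `x_e = y₄`; no twist is needed
because `x_a` is invariant) the lifted action is the TRIANGULAR translation
`σ_U : ρ ↦ ρ, y₁ ↦ y₁ + ρ, y₂ ↦ y₂ + ρy₁, y₃ ↦ y₃ + ρy₂, y₄ ↦ y₄ + ρy₃` (passengers fixed);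
here `σ_U` is given ABSTRACTLY by this law on `MvPolynomial (Fin n) k` with slots
`ρ = X a`, `y₁ = X b`, `y₂ = X c`, `y₃ = X d`, `y₄ = X e`.

Results.
* `rootChart5_gamma3_invariant`, `rootChart5_gamma4_invariant` (every characteristic, any
  commutative coefficient ring): the INTEGRAL slice invariants
  `γ₃″ = 3y₃ − 3y₁y₂ + y₁³ − ρy₁² + 2ρy₂` (`= 3·y₃′` of RT-J5 §3) and
  `γ₄″ = 4y₄ − 4y₁y₃ − 2y₂² + 4y₁²y₂ − y₁⁴ + ρ(y₁³ − 3y₁y₂ + 3y₃)` (`= 4·y₄′`); together with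
  `γ₂″ = 2y₂ − y₁² + ρy₁` (`= 2·y₂′`, which IS `ToricExit.rootChart4_gamma_invariant`) and the
  Artin–Schreier element `N = y₁^p − ρ^{p−1}y₁` (`ToricExit.rootChart4_artinSchreier`).
* `rootChart5_conj`: the substitution `ψ : x_c ↦ γ₂″, x_d ↦ γ₃″, x_e ↦ γ₄″` (other variables fixed)
  intertwines the pure translation `τ : y₁ ↦ y₁ + ρ` with `σ_U`: `ψ ∘ τ = σ_U ∘ ψ`.
* `rootChart5_subst_surjective` (`2, 3 ∈ kˣ`): `ψ` is onto (explicit preimages of `x_c, x_d, x_e`),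
  hence (`algHom_injective_of_surjective`, Krull dimension) an automorphism of `k[x]`.
* `mem_adjoin_of_rootChart5_eq` (`p ≥ 5`): every `σ_U`-fixed polynomial lies in
  `k[N, γ₂″, γ₃″, γ₄″, xᵢ (i ∉ {b,c,d,e})]`, by transport of B1
  `ToricExit.mem_adjoin_of_translate_eq` along `ψ`; and `rootChart5_fixedPoints_eq`: this
  subalgebra is exactly the fixed ring.
Since `2, 3, 4 ∈ kˣ` for `p ≥ 5`, `k[N, γ₂″, γ₃″, γ₄″, …] = k[ρ, N, y₂′, y₃′, y₄′, …]` of RT-J5 §3;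
the `μ₄`-weights `(ρ, N, γ₂″, γ₃″, γ₄″) ↦ (1, p̄, 2, 3, 0)` then exhibit the chart quotient as
`¼(1, p̄, 2, 3) × 𝔸¹` (downstream; not used here). No algebraic independence is claimed or used.
-/

-- single-problem summit: the doubled namespace component `ResolutionOfSingularities` is forced
set_option linter.dupNamespace false

noncomputable section

open MvPolynomial

namespace Summit.ResolutionOfSingularities.ResolutionOfSingularities.Theorems.WildQuotientResolution.ToricExit

section Invariants

variable {R : Type*} [CommRing R] {n : ℕ} (σU : MvPolynomial (Fin n) R →+* MvPolynomial (Fin n) R)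
  (a b c d e : Fin n) (ha : σU (X a) = X a) (hb : σU (X b) = X b + X a)
  (hc : σU (X c) = X c + X a * X b) (hd : σU (X d) = X d + X a * X c)
  (he : σU (X e) = X e + X a * X d)

include ha hb hc hd in
/-- **`γ₃″ = 3y₃ − 3y₁y₂ + y₁³ − ρy₁² + 2ρy₂` is invariant** under the triangular translation
`ρ ↦ ρ`, `y₁ ↦ y₁ + ρ`, `y₂ ↦ y₂ + ρy₁`, `y₃ ↦ y₃ + ρy₂` (every characteristic; for `3 ∈ R×` it
is `3·y₃′`, `y₃′ = y₃ − y₁y₂ + y₁³/3 − ρy₁²/3 + 2ρy₂/3` of RT-J5 §3). [OURS · L1 W4.5c] [folklore] -/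
theorem rootChart5_gamma3_invariant :
    σU (3 * X d - 3 * (X b * X c) + X b ^ 3 - X a * X b ^ 2 + 2 * (X a * X c)) =
      3 * X d - 3 * (X b * X c) + X b ^ 3 - X a * X b ^ 2 + 2 * (X a * X c) := by
  simp only [map_add, map_sub, map_mul, map_pow, map_ofNat, ha, hb, hc, hd]
  ring

include ha hb hc hd he in
/-- **`γ₄″ = 4y₄ − 4y₁y₃ − 2y₂² + 4y₁²y₂ − y₁⁴ + ρ(y₁³ − 3y₁y₂ + 3y₃)` is invariant** under the
triangular translation `ρ ↦ ρ`, `y₁ ↦ y₁ + ρ`, `y₂ ↦ y₂ + ρy₁`, `y₃ ↦ y₃ + ρy₂`, `y₄ ↦ y₄ + ρy₃`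
(every characteristic; for `4 ∈ R×` it is `4·y₄′`,
`y₄′ = y₄ − y₁y₃ − y₂²/2 + y₁²y₂ − y₁⁴/4 + ρ(y₁³ − 3y₁y₂ + 3y₃)/4` of RT-J5 §3).
[OURS · L1 W4.5c] [folklore] -/
theorem rootChart5_gamma4_invariant :
    σU (4 * X e - 4 * (X b * X d) - 2 * X c ^ 2 + 4 * (X b ^ 2 * X c) - X b ^ 4
        + X a * X b ^ 3 - 3 * (X a * X b * X c) + 3 * (X a * X d)) =
      4 * X e - 4 * (X b * X d) - 2 * X c ^ 2 + 4 * (X b ^ 2 * X c) - X b ^ 4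
        + X a * X b ^ 3 - 3 * (X a * X b * X c) + 3 * (X a * X d) := by
  simp only [map_add, map_sub, map_mul, map_pow, map_ofNat, ha, hb, hc, hd, he]
  ring

end Invariants

section Fixed

variable (k : Type) [Field k] (n : ℕ)

/-- A surjective `k`-algebra endomorphism of `k[x₁,…,xₙ]` is injective: a nonzero (hence
non-zero-divisor) kernel element would force `dim k[x] + 1 ≤ dim k[x]`
(`ringKrullDim_succ_le_of_surjective`, `dim k[x₁,…,xₙ] = n`). [folklore] -/
theorem algHom_injective_of_surjective
    (ψ : MvPolynomial (Fin n) k →ₐ[k] MvPolynomial (Fin n) k) (hψ : Function.Surjective ψ) :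
    Function.Injective ψ := by
  rw [injective_iff_map_eq_zero]
  intro r hr
  by_contra hr0
  have h := ringKrullDim_succ_le_of_surjective
    (ψ : MvPolynomial (Fin n) k →+* MvPolynomial (Fin n) k) hψ
    (mem_nonZeroDivisors_of_ne_zero hr0) hr
  rw [MvPolynomial.ringKrullDim_of_isNoetherianRing, ringKrullDim_eq_zero_of_field k, zero_add,
    Nat.card_eq_fintype_card, Fintype.card_fin] at h
  have h3 : ((n + 1 : ℕ) : WithBot ℕ∞) ≤ (n : WithBot ℕ∞) := by exact_mod_cast h
  have h4 : n + 1 ≤ n := by exact_mod_cast h3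
  omega

variable (σU : MvPolynomial (Fin n) k ≃ₐ[k] MvPolynomial (Fin n) k) (a b c d e : Fin n)
  (hab : a ≠ b) (hac : a ≠ c) (had : a ≠ d) (hae : a ≠ e) (hbc : b ≠ c) (hbd : b ≠ d)
  (hbe : b ≠ e) (hcd : c ≠ d) (hce : c ≠ e) (hde : d ≠ e)
  (hb : σU (X b) = X b + X a) (hc : σU (X c) = X c + X a * X b)
  (hd : σU (X d) = X d + X a * X c) (he : σU (X e) = X e + X a * X d)
  (hσ : ∀ i, i ≠ b → i ≠ c → i ≠ d → i ≠ e → σU (X i) = X i)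

include hab hac had hae hbc hbd hbe hb hc hd he hσ in
/-- **The conjugation for `J₅` at the `μ₄`-vertex.** For any substitution datum `g` with
`g c = γ₂″`, `g d = γ₃″`, `g e = γ₄″` and `g i = xᵢ` otherwise, the substitution `ψ = aeval g`
intertwines the pure translation `τ : y₁ ↦ y₁ + ρ` with `σ_U`: `ψ (τ y) = σ_U (ψ y)`.
[OURS · L1 W4.5c] [folklore] -/
theorem rootChart5_conj (g : Fin n → MvPolynomial (Fin n) k)
    (hgc : g c = 2 * X c - X b ^ 2 + X a * X b)
    (hgd : g d = 3 * X d - 3 * (X b * X c) + X b ^ 3 - X a * X b ^ 2 + 2 * (X a * X c))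
    (hge : g e = 4 * X e - 4 * (X b * X d) - 2 * X c ^ 2 + 4 * (X b ^ 2 * X c) - X b ^ 4
        + X a * X b ^ 3 - 3 * (X a * X b * X c) + 3 * (X a * X d))
    (hgi : ∀ i, i ≠ c → i ≠ d → i ≠ e → g i = X i) (y : MvPolynomial (Fin n) k) :
    aeval g (aeval (fun i : Fin n => if i = b then X b + X a else (X i : MvPolynomial (Fin n) k))
      y) = σU (aeval g y) := by
  classical
  set ψ : MvPolynomial (Fin n) k →ₐ[k] MvPolynomial (Fin n) k := aeval g with hψ
  set τ : MvPolynomial (Fin n) k →ₐ[k] MvPolynomial (Fin n) k :=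
    aeval (fun i : Fin n => if i = b then X b + X a else (X i : MvPolynomial (Fin n) k)) with hτ
  have ha : σU (X a) = X a := hσ a hab hac had hae
  have hψX : ∀ i, ψ (X i) = g i := fun i => aeval_X g i
  have hψa : ψ (X a) = X a := (hψX a).trans (hgi a hac had hae)
  have hψb : ψ (X b) = X b := (hψX b).trans (hgi b hbc hbd hbe)
  have hτX : ∀ i, τ (X i) = if i = b then X b + X a else X i := fun i => aeval_X _ i
  have key : ψ.comp τ =
      (σU : MvPolynomial (Fin n) k →ₐ[k] MvPolynomial (Fin n) k).comp ψ := by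
    refine MvPolynomial.algHom_ext fun i => ?_
    change ψ (τ (X i)) = σU (ψ (X i))
    rw [hτX]
    by_cases hib : i = b
    · subst hib
      rw [if_pos rfl, map_add, hψa, hψb, hb]
    · rw [if_neg hib, hψX]
      by_cases hic : i = c
      · subst hic
        rw [hgc]
        exact (rootChart4_gamma_invariant
          (σU : MvPolynomial (Fin n) k →+* MvPolynomial (Fin n) k) a b i ha hb hc).symm
      · by_cases hid : i = d
        · subst hid
          rw [hgd]
          exact (rootChart5_gamma3_invariant
            (σU : MvPolynomial (Fin n) k →+* MvPolynomial (Fin n) k) a b c i ha hb hc hd).symm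
        · by_cases hie : i = e
          · subst hie
            rw [hge]
            exact (rootChart5_gamma4_invariant
              (σU : MvPolynomial (Fin n) k →+* MvPolynomial (Fin n) k) a b c d i
              ha hb hc hd he).symm
          · rw [hgi i hic hid hie, hσ i hib hic hid hie]
  exact congrArg (fun φ : MvPolynomial (Fin n) k →ₐ[k] MvPolynomial (Fin n) k => φ y) key

include hac had hae hbc hbd hbe in
/-- **The slice substitution is onto** (`2, 3 ∈ kˣ`): `ψ = aeval g` (`g c = γ₂″`, `g d = γ₃″`,
`g e = γ₄″`, `g i = xᵢ` otherwise) hits `x_c = ψ(½(x_c + y₁² − ρy₁))`, then `x_d`, then `x_e`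
(triangularity), hence every polynomial. [OURS · L1 W4.5c] [folklore] -/
theorem rootChart5_subst_surjective (h2 : (2 : k) ≠ 0) (h3 : (3 : k) ≠ 0)
    (g : Fin n → MvPolynomial (Fin n) k)
    (hgc : g c = 2 * X c - X b ^ 2 + X a * X b)
    (hgd : g d = 3 * X d - 3 * (X b * X c) + X b ^ 3 - X a * X b ^ 2 + 2 * (X a * X c))
    (hge : g e = 4 * X e - 4 * (X b * X d) - 2 * X c ^ 2 + 4 * (X b ^ 2 * X c) - X b ^ 4
        + X a * X b ^ 3 - 3 * (X a * X b * X c) + 3 * (X a * X d))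
    (hgi : ∀ i, i ≠ c → i ≠ d → i ≠ e → g i = X i) :
    Function.Surjective (aeval g : MvPolynomial (Fin n) k →ₐ[k] MvPolynomial (Fin n) k) := by
  classical
  set ψ : MvPolynomial (Fin n) k →ₐ[k] MvPolynomial (Fin n) k := aeval g with hψ
  have h4 : (4 : k) ≠ 0 := by
    rw [show (4 : k) = 2 * 2 by norm_num]
    exact mul_ne_zero h2 h2
  have h2C : (2 : MvPolynomial (Fin n) k) * C (2⁻¹ : k) = 1 := JordanFour.two_mul_C_inv_two k n h2
  have h3C : (3 : MvPolynomial (Fin n) k) * C (3⁻¹ : k) = 1 :=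
    JordanFour.three_mul_C_inv_three k n h3
  have h4C : (4 : MvPolynomial (Fin n) k) * C (4⁻¹ : k) = 1 := by
    rw [← map_ofNat C 4, ← map_mul, mul_inv_cancel₀ h4, map_one]
  have hψX : ∀ i, ψ (X i) = g i := fun i => aeval_X g i
  have hψa : ψ (X a) = X a := (hψX a).trans (hgi a hac had hae)
  have hψb : ψ (X b) = X b := (hψX b).trans (hgi b hbc hbd hbe)
  have hψc : ψ (X c) = 2 * X c - X b ^ 2 + X a * X b := (hψX c).trans hgc
  have hψd : ψ (X d) = 3 * X d - 3 * (X b * X c) + X b ^ 3 - X a * X b ^ 2 + 2 * (X a * X c) :=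
    (hψX d).trans hgd
  have hψe : ψ (X e) = 4 * X e - 4 * (X b * X d) - 2 * X c ^ 2 + 4 * (X b ^ 2 * X c) - X b ^ 4
      + X a * X b ^ 3 - 3 * (X a * X b * X c) + 3 * (X a * X d) := (hψX e).trans hge
  have hψC : ∀ r : k, ψ (C r) = C r := fun r => ψ.commutes r
  -- explicit preimages of `x_c`, `x_d`, `x_e`
  have hXc : ψ (C (2⁻¹ : k) * (X c + X b ^ 2 - X a * X b)) = X c := by
    simp only [map_mul, map_sub, map_add, map_pow, hψC, hψa, hψb, hψc]
    linear_combination (X c : MvPolynomial (Fin n) k) * h2C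
  obtain ⟨qc, hqc⟩ : ∃ q, ψ q = X c := ⟨_, hXc⟩
  have hXd : ψ (C (3⁻¹ : k) *
      (X d + 3 * (X b * qc) - X b ^ 3 + X a * X b ^ 2 - 2 * (X a * qc))) = X d := by
    simp only [map_mul, map_sub, map_add, map_pow, map_ofNat, hψC, hqc, hψa, hψb, hψd]
    linear_combination (X d : MvPolynomial (Fin n) k) * h3C
  obtain ⟨qd, hqd⟩ : ∃ q, ψ q = X d := ⟨_, hXd⟩
  have hXe : ψ (C (4⁻¹ : k) *
      (X e + 4 * (X b * qd) + 2 * qc ^ 2 - 4 * (X b ^ 2 * qc) + X b ^ 4 - X a * X b ^ 3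
        + 3 * (X a * X b * qc) - 3 * (X a * qd))) = X e := by
    simp only [map_mul, map_sub, map_add, map_pow, map_ofNat, hψC, hqc, hqd, hψa, hψb, hψe]
    linear_combination (X e : MvPolynomial (Fin n) k) * h4C
  have hX : ∀ i, ∃ q, ψ q = X i := by
    intro i
    by_cases hic : i = c
    · subst hic
      exact ⟨qc, hqc⟩
    · by_cases hid : i = d
      · subst hid
        exact ⟨qd, hqd⟩
      · by_cases hie : i = e
        · subst hie
          exact ⟨_, hXe⟩
        · exact ⟨X i, (hψX i).trans (hgi i hic hid hie)⟩
  intro f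
  induction f using MvPolynomial.induction_on with
  | C r => exact ⟨C r, hψC r⟩
  | add p q hp hq =>
    obtain ⟨p', hp'⟩ := hp
    obtain ⟨q', hq'⟩ := hq
    exact ⟨p' + q', by rw [map_add, hp', hq']⟩
  | mul_X p i hp =>
    obtain ⟨p', hp'⟩ := hp
    obtain ⟨q, hq⟩ := hX i
    exact ⟨p' * q, by rw [map_mul, hp', hq]⟩

include hab hac had hae hbc hbd hbe hcd hce hde hb hc hd he hσ in
/-- **Fixed points of the `J₅` root-chart action at the `μ₄`-vertex lie in
`k[N, γ₂″, γ₃″, γ₄″, xᵢ (i ∉ {b,c,d,e})]`** (`p ≥ 5`), `N = y₁^p − ρ^{p−1}y₁`: conjugate `σ_U`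
to the pure translation by the slice substitution `ψ` (`rootChart5_conj`; `ψ` is an automorphism
by `rootChart5_subst_surjective` + `algHom_injective_of_surjective`) and apply B1
`ToricExit.mem_adjoin_of_translate_eq`. [OURS · L1 W4.5c] -/
theorem mem_adjoin_of_rootChart5_eq (p : ℕ) (hp : p.Prime) (hp5 : 5 ≤ p) [CharP k p]
    (f : MvPolynomial (Fin n) k) (hf : σU f = f) :
    f ∈ Algebra.adjoin k (({X b ^ p - X a ^ (p - 1) * X b,
        2 * X c - X b ^ 2 + X a * X b,
        3 * X d - 3 * (X b * X c) + X b ^ 3 - X a * X b ^ 2 + 2 * (X a * X c),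
        4 * X e - 4 * (X b * X d) - 2 * X c ^ 2 + 4 * (X b ^ 2 * X c) - X b ^ 4
          + X a * X b ^ 3 - 3 * (X a * X b * X c) + 3 * (X a * X d)} :
        Set (MvPolynomial (Fin n) k)) ∪
      ((fun i => X i) '' {i | i ≠ b ∧ i ≠ c ∧ i ≠ d ∧ i ≠ e})) := by
  classical
  have h2 : (2 : k) ≠ 0 := JordanFour.two_ne_zero_of_charP k p hp5
  have h3 : (3 : k) ≠ 0 := JordanFour.three_ne_zero_of_charP k p hp5
  set N : MvPolynomial (Fin n) k := X b ^ p - X a ^ (p - 1) * X b with hN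
  set γ2 : MvPolynomial (Fin n) k := 2 * X c - X b ^ 2 + X a * X b with hγ2
  set γ3 : MvPolynomial (Fin n) k :=
    3 * X d - 3 * (X b * X c) + X b ^ 3 - X a * X b ^ 2 + 2 * (X a * X c) with hγ3
  set γ4 : MvPolynomial (Fin n) k :=
    4 * X e - 4 * (X b * X d) - 2 * X c ^ 2 + 4 * (X b ^ 2 * X c) - X b ^ 4
      + X a * X b ^ 3 - 3 * (X a * X b * X c) + 3 * (X a * X d) with hγ4
  set T := Algebra.adjoin k (({N, γ2, γ3, γ4} : Set (MvPolynomial (Fin n) k)) ∪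
      ((fun i => X i) '' {i | i ≠ b ∧ i ≠ c ∧ i ≠ d ∧ i ≠ e})) with hT
  -- the slice substitution `ψ = aeval g`
  let g : Fin n → MvPolynomial (Fin n) k := fun i =>
    if i = c then γ2 else if i = d then γ3 else if i = e then γ4 else X i
  have hgc : g c = γ2 := if_pos rfl
  have hgd : g d = γ3 := by
    change (if d = c then γ2 else if d = d then γ3 else if d = e then γ4 else X d) = γ3
    rw [if_neg (Ne.symm hcd), if_pos rfl]
  have hge : g e = γ4 := by
    change (if e = c then γ2 else if e = d then γ3 else if e = e then γ4 else X e) = γ4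
    rw [if_neg (Ne.symm hce), if_neg (Ne.symm hde), if_pos rfl]
  have hgi : ∀ i, i ≠ c → i ≠ d → i ≠ e → g i = X i := by
    intro i hic hid hie
    change (if i = c then γ2 else if i = d then γ3 else if i = e then γ4 else X i) = X i
    rw [if_neg hic, if_neg hid, if_neg hie]
  set ψ : MvPolynomial (Fin n) k →ₐ[k] MvPolynomial (Fin n) k := aeval g with hψ
  have hψX : ∀ i, ψ (X i) = g i := fun i => aeval_X g i
  have hψa : ψ (X a) = X a := (hψX a).trans (hgi a hac had hae)
  have hψb : ψ (X b) = X b := (hψX b).trans (hgi b hbc hbd hbe)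
  -- `ψ` is an automorphism
  have hsurj : Function.Surjective ψ :=
    rootChart5_subst_surjective k n a b c d e hac had hae hbc hbd hbe h2 h3 g hgc hgd hge hgi
  have hinj : Function.Injective ψ := algHom_injective_of_surjective k n ψ hsurj
  -- `f = ψ q` with `q` fixed by the pure translation
  obtain ⟨q, rfl⟩ := hsurj f
  have hτq : aeval (fun i : Fin n => if i = b then X b + X a else (X i : MvPolynomial (Fin n) k))
      q = q := by
    apply hinj
    rw [hψ, rootChart5_conj k n σU a b c d e hab hac had hae hbc hbd hbe hb hc hd he hσ g hgc hgd
      hge hgi q]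
    exact hf
  have hq : q ∈ Algebra.adjoin k (({X b ^ p - X a ^ (p - 1) * X b} :
      Set (MvPolynomial (Fin n) k)) ∪ ((fun i => X i) '' {i | i ≠ b})) :=
    mem_adjoin_of_translate_eq k n a b hab p hp q hτq
  -- `ψ` maps `k[N, xᵢ (i ≠ b)]` into `T`
  have hmap : Subalgebra.map ψ (Algebra.adjoin k (({X b ^ p - X a ^ (p - 1) * X b} :
      Set (MvPolynomial (Fin n) k)) ∪ ((fun i => X i) '' {i | i ≠ b}))) ≤ T := by
    rw [AlgHom.map_adjoin, hT]
    refine Algebra.adjoin_le ?_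
    rintro _ ⟨y, hy, rfl⟩
    rcases hy with hy | ⟨i, hib, rfl⟩
    · rw [Set.mem_singleton_iff] at hy
      subst hy
      rw [map_sub, map_pow, map_mul, map_pow, hψb, hψa]
      exact Algebra.subset_adjoin (Or.inl (Set.mem_insert _ _))
    · change ψ (X i) ∈ _
      by_cases hic : i = c
      · subst hic
        rw [hψX, hgc]
        exact Algebra.subset_adjoin (Or.inl (Set.mem_insert_of_mem _ (Set.mem_insert _ _)))
      · by_cases hid : i = d
        · subst hid
          rw [hψX, hgd]
          exact Algebra.subset_adjoin (Or.inl
            (Set.mem_insert_of_mem _ (Set.mem_insert_of_mem _ (Set.mem_insert _ _))))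
        · by_cases hie : i = e
          · subst hie
            rw [hψX, hge]
            exact Algebra.subset_adjoin (Or.inl (Set.mem_insert_of_mem _
              (Set.mem_insert_of_mem _ (Set.mem_insert_of_mem _ (Set.mem_singleton _)))))
          · rw [hψX, hgi i hic hid hie]
            exact Algebra.subset_adjoin (Or.inr ⟨i, ⟨hib, hic, hid, hie⟩, rfl⟩)
  exact hmap (Subalgebra.mem_map.mpr ⟨q, hq, rfl⟩)

include hab hac had hae hbc hbd hbe hcd hce hde hb hc hd he hσ in
/-- **The fixed ring of the `J₅` root-chart action at the `μ₄`-vertex IS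
`k[N, γ₂″, γ₃″, γ₄″, xᵢ (i ∉ {b,c,d,e})]`** (`p ≥ 5`): `⊆` is `mem_adjoin_of_rootChart5_eq`;
`⊇` because the generators are fixed (`rootChart4_artinSchreier`, `rootChart4_gamma_invariant`,
`rootChart5_gamma3_invariant`, `rootChart5_gamma4_invariant`) and fixed points form a subalgebra.
[OURS · L1 W4.5c] -/
theorem rootChart5_fixedPoints_eq (p : ℕ) (hp : p.Prime) (hp5 : 5 ≤ p) [CharP k p] :
    {f : MvPolynomial (Fin n) k | σU f = f} =
      ↑(Algebra.adjoin k (({X b ^ p - X a ^ (p - 1) * X b,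
          2 * X c - X b ^ 2 + X a * X b,
          3 * X d - 3 * (X b * X c) + X b ^ 3 - X a * X b ^ 2 + 2 * (X a * X c),
          4 * X e - 4 * (X b * X d) - 2 * X c ^ 2 + 4 * (X b ^ 2 * X c) - X b ^ 4
            + X a * X b ^ 3 - 3 * (X a * X b * X c) + 3 * (X a * X d)} :
          Set (MvPolynomial (Fin n) k)) ∪
        ((fun i => X i) '' {i | i ≠ b ∧ i ≠ c ∧ i ≠ d ∧ i ≠ e}))) := by
  classical
  haveI : Fact p.Prime := ⟨hp⟩
  have ha : σU (X a) = X a := hσ a hab hac had hae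
  refine Set.Subset.antisymm (fun f hf => ?_) (fun f hf => ?_)
  · exact mem_adjoin_of_rootChart5_eq k n σU a b c d e hab hac had hae hbc hbd hbe hcd hce hde
      hb hc hd he hσ p hp hp5 f hf
  · have hle : Algebra.adjoin k (({X b ^ p - X a ^ (p - 1) * X b,
          2 * X c - X b ^ 2 + X a * X b,
          3 * X d - 3 * (X b * X c) + X b ^ 3 - X a * X b ^ 2 + 2 * (X a * X c),
          4 * X e - 4 * (X b * X d) - 2 * X c ^ 2 + 4 * (X b ^ 2 * X c) - X b ^ 4
            + X a * X b ^ 3 - 3 * (X a * X b * X c) + 3 * (X a * X d)} :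
          Set (MvPolynomial (Fin n) k)) ∪
        ((fun i => X i) '' {i | i ≠ b ∧ i ≠ c ∧ i ≠ d ∧ i ≠ e})) ≤
        AlgHom.equalizer (σU : MvPolynomial (Fin n) k →ₐ[k] MvPolynomial (Fin n) k)
          (AlgHom.id k (MvPolynomial (Fin n) k)) := by
      refine Algebra.adjoin_le ?_
      rintro y (hy | ⟨i, ⟨hib, hic, hid, hie⟩, rfl⟩)
      · rw [SetLike.mem_coe, AlgHom.mem_equalizer]
        change σU y = y
        rcases hy with rfl | rfl | rfl | hy
        · exact rootChart4_artinSchreier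
            (σU : MvPolynomial (Fin n) k →+* MvPolynomial (Fin n) k) a b ha hb p
        · exact rootChart4_gamma_invariant
            (σU : MvPolynomial (Fin n) k →+* MvPolynomial (Fin n) k) a b c ha hb hc
        · exact rootChart5_gamma3_invariant
            (σU : MvPolynomial (Fin n) k →+* MvPolynomial (Fin n) k) a b c d ha hb hc hd
        · rw [Set.mem_singleton_iff] at hy
          subst hy
          exact rootChart5_gamma4_invariant
            (σU : MvPolynomial (Fin n) k →+* MvPolynomial (Fin n) k) a b c d e ha hb hc hd he
      · rw [SetLike.mem_coe, AlgHom.mem_equalizer]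
        exact hσ i hib hic hid hie
    exact (AlgHom.mem_equalizer _ _ f).mp (hle hf)

end Fixed

end Summit.ResolutionOfSingularities.ResolutionOfSingularities.Theorems.WildQuotientResolution.ToricExit

end
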